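import Summits.CriticalPhenomena.PercolationContinuityZ3.Theorems.PercNearOneGluingNoHeavyLowerTailPairSaturationAbstract
import Summits.CriticalPhenomena.PercolationContinuityZ3.Theorems.PercNearOneGluingNoHeavyLowerTailThreePartitionSaturation
import Summits.CriticalPhenomena.PercolationContinuityZ3.Theorems.PercNearOneGluingNoHeavyLowerTailThreePartitionCensored

/-!
# Twisted three-partition positivity (★★) = (M⁺-3): **PAIR SATURATION ON THE CUBE** —
# for every finite ground set and every twist, `N_τ ≥ 0` is decided by the DUAL-CONE MEMBERSHIP of the profile `y ↦ N_τ(A,B,{y})` of the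
# MUTUALLY SATURATED PAIRS of up-sets (2-coloured antichains with a large free antichain)

Support file (cell `prim-sahi`, seat `prim-sahi-typer` gen 34; `--supports stmt-CriticalPhenomena-4575`).  Pure proofs, no definitions, no `sorry`,
standard axioms.  Vocabulary of `…ThreePartitionADTwisted` (`triT`, `topT`, `deeT`, `teeT`, `threePartNT`), `…ThreePartitionVOrder(Nested)` (slot
symmetries), `…ThreePartitionSaturation` (the comb sign law `threePartNT_insert_le'`), `…ThreePartitionCensored` (`triT_mono`, `triT_eq_zero`) and
`…PairSaturationAbstract` (`PairSat.*`).  This is the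
dimension-free half of the SIX-LETTER programme for (M⁺-3) (Kahn's Conjecture 5 / Sahi's `C₃` coefficientwise on `{0,1}^6`); the finite half is a
checker of the dual-cone memberships (later files).

THE MATHEMATICS.  The twisted functional `N_τ = threePartNT τ` is ADDITIVE in its third slot with no hypothesis on the families
(`threePartNT_union₃`; hence `N_τ(𝒰,𝒱,↑C) = Σ_{y∈C} N_τ(𝒰,𝒱,{y})`, `threePartNT_coe_eq_sum`), it is slot-symmetric (tree), and its profile
`y ↦ N_τ(𝒰,𝒱,{y})` obeys the SIGN LAW: `≤ 0` for `y ∉ 𝒰 ∩ 𝒱` and up-sets `𝒰, 𝒱` (`threePartNT_singleton₃_nonpos` — the comb sign law of gen 33,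
Kleitman on a folding fibre) and **`≥ 0` for `y ∈ 𝒰 ∩ 𝒱`** (`threePartNT_singleton₃_nonneg`, new — inclusion–exclusion on the fibre `{x₃ = y}`:
`deeT(𝒰,{y}) + deeT(𝒱,{y}) ≤ topT{y} + teeT(𝒰,𝒱,{y})` and `deeT({y},𝒰∩𝒱) ≤ topT{y}`; the fibre form of Sahi's
`E₃(1_𝒰,1_𝒱,δ_y) = μ(y)[(1−μ𝒰)(1−μ𝒱) + 1 − μ(𝒰∩𝒱)]`).  So `PairSat.nonneg_of_pairCond` applies:
**`ThreePartition.threePartNT_nonneg_of_pairCond`** — for a finite `ι` and a twist `τ ⊆ ι`, if `y ↦ N_τ(A,B,{y})` lies in the dual cone of the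
up-sets of `2^ι` for every pair `(A,B)` of up-sets of `2^ι` with `PairSat.PairCond`, then `N_τ(𝒰,𝒱,𝒲) ≥ 0` for ALL up-sets `𝒰, 𝒱, 𝒲 ⊆ 2^ι`;
`threePartitionPositivityTwisted_of_pairCond` packages it over all finite types.
COUNTS (C prototype `c63.c` of this seat, exact; pairs with `PairCond` up to the symmetries of the cube and the swap / profiles over all twists):
`m = 4`: 31 / 496; `m = 5`: 885 / 28 320 (against the `4 061 113` coloured-antichain triples of gen 27); `m = 6`: kit job j231241 (memo).  Every
profile passed the dual-cone test (`m ≤ 5` here is a re-derivation of tree theorems; nothing is claimed from the census).  Nothing here asserts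
(★★), (M⁺-3), Kahn's Conjecture 5 or Sahi's `C₃`. [this work]
-/

namespace Summit.CriticalPhenomena.PercolationContinuityZ3.Theorems

/-! ## 1b. The relative form: only up-sets with FREE co-generators need to be tested -/

namespace PairSat

open Finset
open scoped Classical

variable {α : Type*} [Fintype α] [PartialOrder α]

/-- `InDualRel c N`: `Σ_{y∈U} c y ≥ 0` for every up-set `U` all of whose maximal non-elements are free with respect to `N` (a RELATIVE dual
cone: fewer constraints than `InDual`). [this work] -/
def InDualRel (c : α → ℤ) (N : Finset α) : Prop :=
  ∀ U : Finset α, IsUpperSet (U : Set α) → (∀ q ∈ coGen U, Free N q) → 0 ≤ ∑ y ∈ U, c y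

/-- The relative dual cone contains the dual cone. [this work] -/
theorem inDualRel_of_inDual {c : α → ℤ} (h : InDual c) (N : Finset α) : InDualRel c N := fun U hU _ => h U hU

/-- In normal form the maximal non-elements of the third slot are free with respect to those of the first two. [this work] -/
theorem IsNF.free_coGen₃ {A B C : Finset α} (h : IsNF A B C) : ∀ q ∈ coGen C, Free (coGen A ∪ coGen B) q := by
  intro q hq z hz
  have hqC : q ∉ C := (mem_coGen.1 hq).1
  have hqA : q ∈ A := (h.s1C q hq).1
  have hqB : q ∈ B := (h.s1C q hq).2
  rcases mem_union.1 hz with hz | hz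
  · exact ⟨fun hle => (mem_coGen.1 hz).1 (h.upA hle hqA), fun hle => hqC (h.upC hle (h.s1A z hz).2)⟩
  · exact ⟨fun hle => (mem_coGen.1 hz).1 (h.upB hle hqB), fun hle => hqC (h.upC hle (h.s1B z hz).2)⟩

/-- **ABSTRACT PAIR SATURATION, RELATIVE FORM**: it suffices that, for every pair `(A,B)` with `PairCond`, `Σ_{y∈U} P(A,B)(y) ≥ 0` for the
up-sets `U` whose maximal non-elements are free with respect to `coGen A ∪ coGen B` (the third slot of a normal form is such a `U`). [this work] -/
theorem nonneg_of_pairCondRel {S : Finset α → Finset α → Finset α → ℤ} {P : Finset α → Finset α → α → ℤ} (hS : SignedProfile S P)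
    (H : ∀ A B : Finset α, PairCond A B → InDualRel (P A B) (coGen A ∪ coGen B))
    (A B C : Finset α) (hA : IsUpperSet (A : Set α)) (hB : IsUpperSet (B : Set α)) (hC : IsUpperSet (C : Set α)) :
    0 ≤ S A B C := by
  obtain ⟨A', B', C', hnf, hle⟩ := exists_isNF_le hS (phi A B C) A B C hA hB hC (le_refl _)
  refine le_trans ?_ hle
  by_cases hc : (coGen A').card ≤ (coGen C').card ∧ (coGen B').card ≤ (coGen C').card
  · rw [hS.sum_eq]
    exact H A' B' (pairCond_of_isNF hnf hc.1 hc.2) C' hnf.upC hnf.free_coGen₃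
  · by_cases ha : (coGen B').card ≤ (coGen A').card ∧ (coGen C').card ≤ (coGen A').card
    · rw [hS.swap12, hS.swap23, hS.sum_eq]
      exact H B' C' (pairCond_of_isNF hnf.swap12.swap23 ha.1 ha.2) A' hnf.upA hnf.swap12.swap23.free_coGen₃
    · have hb : (coGen A').card ≤ (coGen B').card ∧ (coGen C').card ≤ (coGen B').card := by omega
      rw [hS.swap23, hS.sum_eq]
      exact H A' C' (pairCond_of_isNF hnf.swap23 hb.1 hb.2) B' hnf.upB hnf.swap23.free_coGen₃

end PairSat

/-! ## 2. The cube instance: the twisted three-partition functional -/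

namespace ThreePartition

open Finset
open scoped symmDiff Classical

variable {ι : Type*} [Fintype ι]

/-- Inclusion–exclusion for twisted counts: `#(p ∧ (q ∨ r)) + #(p ∧ q ∧ r) = #(p ∧ q) + #(p ∧ r)`. [this work] -/
theorem triT_and_or_add (τ : Set ι) (p q r : Set ι → Set ι → Set ι → Prop) :
    triT τ (fun a b c => p a b c ∧ (q a b c ∨ r a b c)) + triT τ (fun a b c => p a b c ∧ (q a b c ∧ r a b c))
      = triT τ (fun a b c => p a b c ∧ q a b c) + triT τ (fun a b c => p a b c ∧ r a b c) := by
  have e1 := triT_and_add_triT_and_not τ (fun a b c => p a b c ∧ (q a b c ∨ r a b c)) q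
  have e2 := triT_and_add_triT_and_not τ (fun a b c => p a b c ∧ r a b c) q
  have h1 : triT τ (fun a b c => (p a b c ∧ (q a b c ∨ r a b c)) ∧ q a b c) = triT τ (fun a b c => p a b c ∧ q a b c) :=
    triT_congr fun a b c => by tauto
  have h2 : triT τ (fun a b c => (p a b c ∧ (q a b c ∨ r a b c)) ∧ ¬ q a b c)
      = triT τ (fun a b c => (p a b c ∧ r a b c) ∧ ¬ q a b c) :=
    triT_congr fun a b c => by tauto
  have h3 : triT τ (fun a b c => (p a b c ∧ r a b c) ∧ q a b c) = triT τ (fun a b c => p a b c ∧ (q a b c ∧ r a b c)) :=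
    triT_congr fun a b c => by tauto
  rw [h1, h2] at e1
  rw [h3] at e2
  omega

/-- `topT` is additive over disjoint unions. [this work] -/
theorem topT_union (τ : Set ι) {𝒳 𝒴 : Set (Set ι)} (h : Disjoint 𝒳 𝒴) : topT τ (𝒳 ∪ 𝒴) = topT τ 𝒳 + topT τ 𝒴 := by
  unfold topT
  rw [← triT_or]
  · exact triT_congr fun a b c => by simp only [Set.mem_union]
  · intro a b c hh; exact Set.disjoint_left.1 h hh.1 hh.2

/-- `teeT` is additive over disjoint unions in its third slot. [this work] -/
theorem teeT_union₃ (τ : Set ι) (𝒰 𝒱 : Set (Set ι)) {𝒳 𝒴 : Set (Set ι)} (h : Disjoint 𝒳 𝒴) :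
    teeT τ 𝒰 𝒱 (𝒳 ∪ 𝒴) = teeT τ 𝒰 𝒱 𝒳 + teeT τ 𝒰 𝒱 𝒴 := by
  unfold teeT
  rw [← triT_or]
  · exact triT_congr fun a b c => by simp only [Set.mem_union]; tauto
  · intro a b c hh; exact Set.disjoint_left.1 h hh.1.2.2 hh.2.2.2

/-- `deeT` is additive over disjoint unions in its first slot. [this work] -/
theorem deeT_union_left (τ : Set ι) {𝒳 𝒴 : Set (Set ι)} (h : Disjoint 𝒳 𝒴) (ℬ : Set (Set ι)) :
    deeT τ (𝒳 ∪ 𝒴) ℬ = deeT τ 𝒳 ℬ + deeT τ 𝒴 ℬ := by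
  unfold deeT
  rw [← triT_or]
  · exact triT_congr fun a b c => by simp only [Set.mem_union]; tauto
  · intro a b c hh; exact Set.disjoint_left.1 h hh.1.1 hh.2.1

/-- `deeT` is additive over disjoint unions in its second slot. [this work] -/
theorem deeT_union_right (τ : Set ι) (𝒜 : Set (Set ι)) {𝒳 𝒴 : Set (Set ι)} (h : Disjoint 𝒳 𝒴) :
    deeT τ 𝒜 (𝒳 ∪ 𝒴) = deeT τ 𝒜 𝒳 + deeT τ 𝒜 𝒴 := by
  unfold deeT
  rw [← triT_or]
  · exact triT_congr fun a b c => by simp only [Set.mem_union]; tauto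
  · intro a b c hh; exact Set.disjoint_left.1 h hh.1.2 hh.2.2

/-- **`N_τ` is additive in its third slot**: `N_τ(𝒰,𝒱,𝒲₁ ∪ 𝒲₂) = N_τ(𝒰,𝒱,𝒲₁) + N_τ(𝒰,𝒱,𝒲₂)` for disjoint `𝒲₁, 𝒲₂`
(no hypothesis on the families). [this work] -/
theorem threePartNT_union₃ (τ : Set ι) (𝒰 𝒱 : Set (Set ι)) {𝒲₁ 𝒲₂ : Set (Set ι)} (h : Disjoint 𝒲₁ 𝒲₂) :
    threePartNT τ 𝒰 𝒱 (𝒲₁ ∪ 𝒲₂) = threePartNT τ 𝒰 𝒱 𝒲₁ + threePartNT τ 𝒰 𝒱 𝒲₂ := by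
  have h1 : Disjoint (𝒰 ∩ 𝒱 ∩ 𝒲₁) (𝒰 ∩ 𝒱 ∩ 𝒲₂) := h.mono Set.inter_subset_right Set.inter_subset_right
  have h2 : Disjoint (𝒱 ∩ 𝒲₁) (𝒱 ∩ 𝒲₂) := h.mono Set.inter_subset_right Set.inter_subset_right
  have h3 : Disjoint (𝒰 ∩ 𝒲₁) (𝒰 ∩ 𝒲₂) := h.mono Set.inter_subset_right Set.inter_subset_right
  unfold threePartNT
  rw [Set.inter_union_distrib_left (𝒰 ∩ 𝒱), Set.inter_union_distrib_left 𝒱, Set.inter_union_distrib_left 𝒰,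
    topT_union τ h1, teeT_union₃ τ 𝒰 𝒱 h, deeT_union_right τ 𝒰 h2, deeT_union_right τ 𝒱 h3, deeT_union_left τ h]
  push_cast
  ring

/-- `N_τ(𝒰,𝒱,∅) = 0`. [this work] -/
theorem threePartNT_empty₃ (τ : Set ι) (𝒰 𝒱 : Set (Set ι)) : threePartNT τ 𝒰 𝒱 ∅ = 0 := by
  have e1 : topT τ (∅ : Set (Set ι)) = 0 := by unfold topT; exact triT_eq_zero τ fun a b c hh => hh
  have e2 : teeT τ 𝒰 𝒱 ∅ = 0 := by unfold teeT; exact triT_eq_zero τ fun a b c hh => hh.2.2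
  have e3 : deeT τ 𝒰 (∅ : Set (Set ι)) = 0 := by unfold deeT; exact triT_eq_zero τ fun a b c hh => hh.2
  have e4 : deeT τ 𝒱 (∅ : Set (Set ι)) = 0 := by unfold deeT; exact triT_eq_zero τ fun a b c hh => hh.2
  have e5 : deeT τ (∅ : Set (Set ι)) (𝒰 ∩ 𝒱) = 0 := by unfold deeT; exact triT_eq_zero τ fun a b c hh => hh.1
  unfold threePartNT
  rw [Set.inter_empty, Set.inter_empty, Set.inter_empty, e1, e2, e3, e4, e5]
  simp

/-- `N_τ(∅,𝒱,𝒲) = 0`. [this work] -/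
theorem threePartNT_empty₁ (τ : Set ι) (𝒱 𝒲 : Set (Set ι)) : threePartNT τ ∅ 𝒱 𝒲 = 0 := by
  rw [threePartNT_swap12, threePartNT_swap23, threePartNT_empty₃]

/-- **`N_τ` is the sum of its profile over the third slot**: for a finset `C` of points of `2^ι`,
`N_τ(𝒰,𝒱,↑C) = Σ_{y∈C} N_τ(𝒰,𝒱,{y})`. [this work] -/
theorem threePartNT_coe_eq_sum (τ : Set ι) (𝒰 𝒱 : Set (Set ι)) (C : Finset (Set ι)) :
    threePartNT τ 𝒰 𝒱 (↑C : Set (Set ι)) = ∑ y ∈ C, threePartNT τ 𝒰 𝒱 {y} := by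
  induction C using Finset.induction_on with
  | empty => rw [coe_empty, threePartNT_empty₃, sum_empty]
  | insert y C hy ih =>
    rw [coe_insert, Set.insert_eq, threePartNT_union₃ τ 𝒰 𝒱 (Set.disjoint_singleton_left.2 (fun h => hy (mem_coe.1 h))),
      sum_insert hy, ih]

/-- **Sign law, negative side**: for up-sets `𝒰, 𝒱` and `y ∉ 𝒰 ∩ 𝒱`, `N_τ(𝒰,𝒱,{y}) ≤ 0` (the comb sign law of gen 33 in the third
slot). [this work] -/
theorem threePartNT_singleton₃_nonpos (τ : Set ι) {𝒰 𝒱 : Set (Set ι)} (h𝒰 : IsUpperSet 𝒰) (h𝒱 : IsUpperSet 𝒱) {y : Set ι}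
    (hy : ¬ (y ∈ 𝒰 ∧ y ∈ 𝒱)) : threePartNT τ 𝒰 𝒱 {y} ≤ 0 := by
  have hy' : y ∉ 𝒰 ∨ y ∉ 𝒱 := by tauto
  rw [threePartNT_swap23, threePartNT_swap12, ← threePartNT_empty₁ τ 𝒰 𝒱]
  have key := threePartNT_insert_le' τ h𝒰 h𝒱 (Set.notMem_empty y) hy'
  rwa [insert_empty_eq] at key

/-- **Sign law, positive side**: for `y ∈ 𝒰 ∩ 𝒱` (any families), `N_τ(𝒰,𝒱,{y}) ≥ 0`.  On the fibre `{x₃ = y}`: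
`deeT(𝒰,{y}) + deeT(𝒱,{y}) ≤ topT{y} + teeT(𝒰,𝒱,{y})` (inclusion–exclusion) and `deeT({y},𝒰∩𝒱) ≤ topT{y}`; this is the fibre form of
`E₃(1_𝒰,1_𝒱,δ_y) = μ(y)[(1−μ𝒰)(1−μ𝒱) + 1 − μ(𝒰∩𝒱)] ≥ 0`. [this work] -/
theorem threePartNT_singleton₃_nonneg (τ : Set ι) (𝒰 𝒱 : Set (Set ι)) {y : Set ι} (hy𝒰 : y ∈ 𝒰) (hy𝒱 : y ∈ 𝒱) :
    0 ≤ threePartNT τ 𝒰 𝒱 {y} := by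
  have h1 : 𝒰 ∩ 𝒱 ∩ {y} = {y} := by
    ext S; simp only [Set.mem_inter_iff, Set.mem_singleton_iff]
    constructor
    · exact fun h => h.2
    · rintro rfl; exact ⟨⟨hy𝒰, hy𝒱⟩, rfl⟩
  have h2 : 𝒱 ∩ {y} = {y} := by
    ext S; simp only [Set.mem_inter_iff, Set.mem_singleton_iff]
    constructor
    · exact fun h => h.2
    · rintro rfl; exact ⟨hy𝒱, rfl⟩
  have h3 : 𝒰 ∩ {y} = {y} := by
    ext S; simp only [Set.mem_inter_iff, Set.mem_singleton_iff]
    constructor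
    · exact fun h => h.2
    · rintro rfl; exact ⟨hy𝒰, rfl⟩
  -- the four counts on the fibre `{x₃ = y}` as twisted counts of conjunctions with `p := (x₃ ∈ {y})`
  have eTop : topT τ {y} = triT τ (fun _ _ c => c ∈ ({y} : Set (Set ι))) := rfl
  have eDU : deeT τ 𝒰 {y} = triT τ (fun a _ c => c ∈ ({y} : Set (Set ι)) ∧ a ∈ 𝒰) :=
    triT_congr fun a b c => by tauto
  have eDV : deeT τ 𝒱 {y} = triT τ (fun _ b c => c ∈ ({y} : Set (Set ι)) ∧ b ∈ 𝒱) := by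
    unfold deeT; rw [triT_swap12]; exact triT_congr fun a b c => by tauto
  have eTee : teeT τ 𝒰 𝒱 {y} = triT τ (fun a b c => c ∈ ({y} : Set (Set ι)) ∧ (a ∈ 𝒰 ∧ b ∈ 𝒱)) :=
    triT_congr fun a b c => by tauto
  -- inclusion–exclusion: `deeT(𝒰,{y}) + deeT(𝒱,{y}) ≤ topT{y} + teeT(𝒰,𝒱,{y})`
  have hIE : deeT τ 𝒰 {y} + deeT τ 𝒱 {y} ≤ topT τ {y} + teeT τ 𝒰 𝒱 {y} := by
    rw [eDU, eDV, eTop, eTee, ← triT_and_or_add]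
    refine Nat.add_le_add_right (triT_mono τ fun a b c hh => hh.1) _
  -- `deeT({y}, 𝒰∩𝒱) ≤ topT{y}`
  have hD : deeT τ {y} (𝒰 ∩ 𝒱) ≤ topT τ {y} := by
    rw [deeT_comm, eTop]
    exact triT_mono τ fun a b c hh => hh.2
  unfold threePartNT
  rw [h1, h2, h3]
  push_cast
  have hIE' : (deeT τ 𝒰 {y} : ℤ) + deeT τ 𝒱 {y} ≤ topT τ {y} + teeT τ 𝒰 𝒱 {y} := by exact_mod_cast hIE
  have hD' : (deeT τ {y} (𝒰 ∩ 𝒱) : ℤ) ≤ topT τ {y} := by exact_mod_cast hD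
  linarith

/-! ### The profile in closed form (one part fixed) -/

/-- `cntSub R P`: the number of subsets `S ⊆ R` of the ground set with `P S`. [this work] -/
noncomputable def cntSub (R : Set ι) (P : Set ι → Prop) : ℕ := (univ.filter fun S : Set ι => S ⊆ R ∧ P S).card

omit [Fintype ι] in
/-- From `Aᶜ ∆ τ = y`: `A = (y ∆ τ)ᶜ`. [this work] -/
theorem eq_compl_of_compl_symmDiff_eq {A τ y : Set ι} (h : Aᶜ ∆ τ = y) : A = (y ∆ τ)ᶜ := by
  rw [← h, symmDiff_symmDiff_cancel_right, compl_compl]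

/-- **Counting ordered 3-partitions with the third copy fixed**: `#{(S₁,S₂,S₃) : S₃ ∆ τ = y, Q(S₁∆τ, S₂∆τ)}` is the number of subsets `S` of
`R = (y ∆ τ)ᶜ` with `Q(S ∆ τ, (R ∖ S) ∆ τ)` (`S₁ = S`, `S₂ = R ∖ S`). [this work] -/
theorem triT_third_eq (τ y : Set ι) (Q : Set ι → Set ι → Prop) :
    triT τ (fun a b c => c = y ∧ Q a b) = cntSub (y ∆ τ)ᶜ fun S => Q (S ∆ τ) (((y ∆ τ)ᶜ \ S) ∆ τ) := by
  unfold triT tri cntSub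
  refine card_bij (fun q _ => q.1) (fun q hq => ?_) (fun q hq q' hq' h => ?_) (fun S hS => ?_)
  · simp only [mem_filter, mem_univ, true_and] at hq ⊢
    obtain ⟨hd, hc, hQ⟩ := hq
    have hR : q.1 ∪ q.2 = (y ∆ τ)ᶜ := eq_compl_of_compl_symmDiff_eq hc
    have h2 : (y ∆ τ)ᶜ \ q.1 = q.2 := by
      rw [← hR, Set.union_sdiff_cancel_left (Set.disjoint_iff.1 hd)]
    refine ⟨hR ▸ Set.subset_union_left, ?_⟩
    rw [h2]; exact hQ
  · simp only [mem_filter, mem_univ, true_and] at hq hq'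
    have hR : q.1 ∪ q.2 = (y ∆ τ)ᶜ := eq_compl_of_compl_symmDiff_eq hq.2.1
    have hR' : q'.1 ∪ q'.2 = (y ∆ τ)ᶜ := eq_compl_of_compl_symmDiff_eq hq'.2.1
    have e2 : q.2 = (y ∆ τ)ᶜ \ q.1 := by rw [← hR, Set.union_sdiff_cancel_left (Set.disjoint_iff.1 hq.1)]
    have e2' : q'.2 = (y ∆ τ)ᶜ \ q'.1 := by rw [← hR', Set.union_sdiff_cancel_left (Set.disjoint_iff.1 hq'.1)]
    refine Prod.ext h ?_
    rw [e2, e2', h]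
  · simp only [mem_filter, mem_univ, true_and] at hS
    refine ⟨(S, (y ∆ τ)ᶜ \ S), ?_, rfl⟩
    simp only [mem_filter, mem_univ, true_and]
    have hU : S ∪ (y ∆ τ)ᶜ \ S = (y ∆ τ)ᶜ := Set.union_sdiff_cancel hS.1
    refine ⟨Set.disjoint_sdiff_right, ?_, hS.2⟩
    rw [hU, compl_compl, symmDiff_symmDiff_cancel_right]

/-- `topT τ {y}` = the number of subsets of `(y ∆ τ)ᶜ`. [this work] -/
theorem topT_singleton_eq (τ y : Set ι) : topT τ {y} = cntSub (y ∆ τ)ᶜ fun _ => True := by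
  have h : topT τ {y} = triT τ (fun a b c => c = y ∧ (fun _ _ : Set ι => True) a b) :=
    triT_congr fun a b c => by simp only [Set.mem_singleton_iff, and_true]
  rw [h, triT_third_eq]

/-- `teeT τ 𝒰 𝒱 {y}` in closed form. [this work] -/
theorem teeT_singleton₃_eq (τ : Set ι) (𝒰 𝒱 : Set (Set ι)) (y : Set ι) :
    teeT τ 𝒰 𝒱 {y} = cntSub (y ∆ τ)ᶜ fun S => S ∆ τ ∈ 𝒰 ∧ ((y ∆ τ)ᶜ \ S) ∆ τ ∈ 𝒱 := by
  have h : teeT τ 𝒰 𝒱 {y} = triT τ (fun a b c => c = y ∧ (fun a b : Set ι => a ∈ 𝒰 ∧ b ∈ 𝒱) a b) :=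
    triT_congr fun a b c => by simp only [Set.mem_singleton_iff]; tauto
  rw [h, triT_third_eq]

/-- `deeT τ 𝒳 {y}` in closed form. [this work] -/
theorem deeT_singleton₂_eq (τ : Set ι) (𝒳 : Set (Set ι)) (y : Set ι) :
    deeT τ 𝒳 {y} = cntSub (y ∆ τ)ᶜ fun S => S ∆ τ ∈ 𝒳 := by
  have h : deeT τ 𝒳 {y} = triT τ (fun a b c => c = y ∧ (fun a _ : Set ι => a ∈ 𝒳) a b) :=
    triT_congr fun a b c => by simp only [Set.mem_singleton_iff]; tauto
  rw [h, triT_third_eq]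

/-- **THE PROFILE IN CLOSED FORM.**  For `y ∈ 2^ι`, `R = (y ∆ τ)ᶜ` and any families `𝒰, 𝒱`:
`N_τ(𝒰,𝒱,{y}) = 2·[y ∈ 𝒰∩𝒱]·#{S ⊆ R} + #{S ⊆ R : S∆τ ∈ 𝒰, (R∖S)∆τ ∈ 𝒱} − [y∈𝒱]·#{S ⊆ R : S∆τ ∈ 𝒰} − [y∈𝒰]·#{S ⊆ R : S∆τ ∈ 𝒱} − #{S ⊆ R : S∆τ ∈ 𝒰∩𝒱}`
(the formula evaluated by the checker `…ThreePartitionCubeCheck`). [this work] -/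
theorem threePartNT_singleton₃_eq (τ : Set ι) (𝒰 𝒱 : Set (Set ι)) (y : Set ι) :
    threePartNT τ 𝒰 𝒱 {y} =
      2 * (if y ∈ 𝒰 ∧ y ∈ 𝒱 then (cntSub (y ∆ τ)ᶜ (fun _ => True) : ℤ) else 0)
      + (cntSub (y ∆ τ)ᶜ (fun S => S ∆ τ ∈ 𝒰 ∧ ((y ∆ τ)ᶜ \ S) ∆ τ ∈ 𝒱) : ℤ)
      - (if y ∈ 𝒱 then (cntSub (y ∆ τ)ᶜ (fun S => S ∆ τ ∈ 𝒰) : ℤ) else 0)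
      - (if y ∈ 𝒰 then (cntSub (y ∆ τ)ᶜ (fun S => S ∆ τ ∈ 𝒱) : ℤ) else 0)
      - (cntSub (y ∆ τ)ᶜ (fun S => S ∆ τ ∈ 𝒰 ∩ 𝒱) : ℤ) := by
  have e0 : topT τ (∅ : Set (Set ι)) = 0 := by unfold topT; exact triT_eq_zero τ fun a b c hh => hh
  have e0' : ∀ 𝒳 : Set (Set ι), deeT τ 𝒳 (∅ : Set (Set ι)) = 0 := fun 𝒳 => by
    unfold deeT; exact triT_eq_zero τ fun a b c hh => hh.2
  have hI : ∀ 𝒳 : Set (Set ι), 𝒳 ∩ {y} = (if y ∈ 𝒳 then ({y} : Set (Set ι)) else ∅) := by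
    intro 𝒳
    split_ifs with h
    · ext S; simp only [Set.mem_inter_iff, Set.mem_singleton_iff]
      exact ⟨fun hh => hh.2, fun hh => ⟨hh ▸ h, hh⟩⟩
    · ext S; simp only [Set.mem_inter_iff, Set.mem_singleton_iff, Set.mem_empty_iff_false, iff_false]
      rintro ⟨hh, rfl⟩; exact h hh
  unfold threePartNT
  rw [deeT_comm τ {y} (𝒰 ∩ 𝒱), teeT_singleton₃_eq, deeT_singleton₂_eq τ (𝒰 ∩ 𝒱), hI (𝒰 ∩ 𝒱), hI 𝒰, hI 𝒱]
  by_cases hU : y ∈ 𝒰 <;> by_cases hV : y ∈ 𝒱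
  · have hUV : y ∈ 𝒰 ∩ 𝒱 := ⟨hU, hV⟩
    simp only [hUV, hU, hV, if_true, and_self, topT_singleton_eq, deeT_singleton₂_eq]
    push_cast; ring
  · have hUV : y ∉ 𝒰 ∩ 𝒱 := fun h => hV h.2
    simp only [hUV, hU, hV, if_true, if_false, and_false, e0, e0', deeT_singleton₂_eq]
    push_cast; ring
  · have hUV : y ∉ 𝒰 ∩ 𝒱 := fun h => hU h.1
    simp only [hUV, hU, hV, if_true, if_false, false_and, e0, e0', deeT_singleton₂_eq]
    push_cast; ring
  · have hUV : y ∉ 𝒰 ∩ 𝒱 := fun h => hU h.1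
    simp only [hUV, hU, hV, if_false, and_self, e0, e0']
    push_cast; ring

/-! ### Pair saturation for `N_τ` -/

/-- **PAIR SATURATION ON THE CUBE.**  Fix a finite ground set `ι` and a twist `τ ⊆ ι`.  If for every pair `(A, B)` of up-sets of `2^ι`
satisfying `PairSat.PairCond` (mutually saturated — a 2-coloured antichain —, minimal elements of one inside the other free, a free
antichain at least as large as both colour classes) the profile `y ↦ N_τ(A,B,{y})` lies in the dual cone of the up-sets of `2^ι`, then
`N_τ(𝒰,𝒱,𝒲) ≥ 0` for ALL up-sets `𝒰, 𝒱, 𝒲 ⊆ 2^ι`. [this work] -/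
theorem threePartNT_nonneg_of_pairCond (τ : Set ι)
    (H : ∀ A B : Finset (Set ι), PairSat.PairCond A B →
      PairSat.InDual (fun y : Set ι => threePartNT τ (↑A : Set (Set ι)) ↑B {y}))
    {𝒰 𝒱 𝒲 : Set (Set ι)} (h𝒰 : IsUpperSet 𝒰) (h𝒱 : IsUpperSet 𝒱) (h𝒲 : IsUpperSet 𝒲) :
    0 ≤ threePartNT τ 𝒰 𝒱 𝒲 := by
  let S : Finset (Set ι) → Finset (Set ι) → Finset (Set ι) → ℤ := fun A B C => threePartNT τ ↑A ↑B ↑C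
  let P : Finset (Set ι) → Finset (Set ι) → Set ι → ℤ := fun A B y => threePartNT τ ↑A ↑B {y}
  have hS : PairSat.SignedProfile S P :=
    { sum_eq := fun A B C => threePartNT_coe_eq_sum τ ↑A ↑B C
      swap12 := fun A B C => threePartNT_swap12 τ ↑A ↑B ↑C
      swap23 := fun A B C => threePartNT_swap23 τ ↑A ↑B ↑C
      pos := fun A B _ _ y hyA hyB => threePartNT_singleton₃_nonneg τ ↑A ↑B (mem_coe.2 hyA) (mem_coe.2 hyB)
      neg := fun A B hA hB y hy =>
        threePartNT_singleton₃_nonpos τ hA hB (fun hh => hy ⟨mem_coe.1 hh.1, mem_coe.1 hh.2⟩) }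
  let F𝒰 : Finset (Set ι) := univ.filter (· ∈ 𝒰)
  let F𝒱 : Finset (Set ι) := univ.filter (· ∈ 𝒱)
  let F𝒲 : Finset (Set ι) := univ.filter (· ∈ 𝒲)
  have hcoe : ∀ 𝒳 : Set (Set ι), (↑(univ.filter (· ∈ 𝒳)) : Set (Set ι)) = 𝒳 := by
    intro 𝒳; ext T; simp
  have key := PairSat.nonneg_of_pairCond hS H F𝒰 F𝒱 F𝒲 (by rw [hcoe]; exact h𝒰) (by rw [hcoe]; exact h𝒱)
    (by rw [hcoe]; exact h𝒲)
  have e : S F𝒰 F𝒱 F𝒲 = threePartNT τ 𝒰 𝒱 𝒲 := by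
    show threePartNT τ ↑F𝒰 ↑F𝒱 ↑F𝒲 = _
    rw [hcoe, hcoe, hcoe]
  rw [← e]; exact key

/-- **PAIR SATURATION ON THE CUBE, RELATIVE FORM**: it suffices that `Σ_{y∈C} N_τ(A,B,{y}) ≥ 0` for the pairs `(A,B)` with `PairCond` and the
up-sets `C` of `2^ι` whose maximal non-elements are free with respect to `coGen A ∪ coGen B` (the checker's weaker test). [this work] -/
theorem threePartNT_nonneg_of_pairCondRel (τ : Set ι)
    (H : ∀ A B : Finset (Set ι), PairSat.PairCond A B →
      PairSat.InDualRel (fun y : Set ι => threePartNT τ (↑A : Set (Set ι)) ↑B {y}) (PairSat.coGen A ∪ PairSat.coGen B))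
    {𝒰 𝒱 𝒲 : Set (Set ι)} (h𝒰 : IsUpperSet 𝒰) (h𝒱 : IsUpperSet 𝒱) (h𝒲 : IsUpperSet 𝒲) :
    0 ≤ threePartNT τ 𝒰 𝒱 𝒲 := by
  let S : Finset (Set ι) → Finset (Set ι) → Finset (Set ι) → ℤ := fun A B C => threePartNT τ ↑A ↑B ↑C
  let P : Finset (Set ι) → Finset (Set ι) → Set ι → ℤ := fun A B y => threePartNT τ ↑A ↑B {y}
  have hS : PairSat.SignedProfile S P :=
    { sum_eq := fun A B C => threePartNT_coe_eq_sum τ ↑A ↑B C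
      swap12 := fun A B C => threePartNT_swap12 τ ↑A ↑B ↑C
      swap23 := fun A B C => threePartNT_swap23 τ ↑A ↑B ↑C
      pos := fun A B _ _ y hyA hyB => threePartNT_singleton₃_nonneg τ ↑A ↑B (mem_coe.2 hyA) (mem_coe.2 hyB)
      neg := fun A B hA hB y hy =>
        threePartNT_singleton₃_nonpos τ hA hB (fun hh => hy ⟨mem_coe.1 hh.1, mem_coe.1 hh.2⟩) }
  let F𝒰 : Finset (Set ι) := univ.filter (· ∈ 𝒰)
  let F𝒱 : Finset (Set ι) := univ.filter (· ∈ 𝒱)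
  let F𝒲 : Finset (Set ι) := univ.filter (· ∈ 𝒲)
  have hcoe : ∀ 𝒳 : Set (Set ι), (↑(univ.filter (· ∈ 𝒳)) : Set (Set ι)) = 𝒳 := by
    intro 𝒳; ext T; simp
  have key := PairSat.nonneg_of_pairCondRel hS H F𝒰 F𝒱 F𝒲 (by rw [hcoe]; exact h𝒰) (by rw [hcoe]; exact h𝒱)
    (by rw [hcoe]; exact h𝒲)
  have e : S F𝒰 F𝒱 F𝒲 = threePartNT τ 𝒰 𝒱 𝒲 := by
    show threePartNT τ ↑F𝒰 ↑F𝒱 ↑F𝒲 = _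
    rw [hcoe, hcoe, hcoe]
  rw [← e]; exact key

/-- **(★★) ⟸ pair-saturated dual-cone membership on every finite cube**: if on every finite type the profiles of the pairs with
`PairCond` lie in the dual cone for every twist, then `ThreePartitionPositivityTwisted`. [this work] -/
theorem threePartitionPositivityTwisted_of_pairCond
    (H : ∀ (ι : Type) [Fintype ι] (τ : Set ι) (A B : Finset (Set ι)), PairSat.PairCond A B →
      PairSat.InDual (fun y : Set ι => threePartNT τ (↑A : Set (Set ι)) ↑B {y})) :
    ThreePartitionPositivityTwisted := by
  intro ι _ τ 𝒰 𝒱 𝒲 h𝒰 h𝒱 h𝒲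
  exact threePartNT_nonneg_of_pairCond τ (H ι τ) h𝒰 h𝒱 h𝒲

end ThreePartition

end Summit.CriticalPhenomena.PercolationContinuityZ3.Theorems
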